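import Mathlib.Analysis.SpecialFunctions.Pow.Real
import Mathlib.Analysis.SpecialFunctions.Log.Basic
import Mathlib.Analysis.Complex.ExponentialBounds
import Summits.NavierStokesRegularity.NavierStokesRegularity.Theorems.PerpetualPumpAveragedTypeIBlowupIvtNesting

/-!
# Crux `PerpetualPump.AveragedTypeIBlowup` (stmt-NavierStokesRegularity-1835), line `Sketch`:
# tools for the assembly `stub_oneStepCore` of the window one-step theorem (lead c1)

Elementary numerics of the regime (`σ_P = (5 log B + 20)/B ≤ 1`, the ignition-budget bookkeeping:
`max 0 (log(0.6√(B+4)/(ε̄B))) ≤ log(1/ε̄)`, no ignition within three slow units contradicts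
`b_lo ≥ 10⁴ + 40 + 5 log(1/ε̄)`, the front carrier at ignition is `≥ 10⁴` and ignition happens after
`σ_I = 2Λ₀/B`), and the first-ignition time as a first zero of a continuous function.
-/

noncomputable section
set_option linter.dupNamespace false

open Set

namespace Summit.NavierStokesRegularity.NavierStokesRegularity.Theorems.PerpetualPumpAveragedTypeIBlowup

/-- `log x ≤ 2√x`-type bound: for `x ≥ 10⁴`, `5 log x + 20 ≤ x`, so the pulse horizon
`σ_P = (5 log x + 20)/x` is at most one slow unit, and it is positive. [folklore] -/
theorem oneStepCore_sigmaP_bounds {x : ℝ} (hx : 10 ^ 4 ≤ x) :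
    0 < (5 * Real.log x + 20) / x ∧ (5 * Real.log x + 20) / x ≤ 1 := by
  have hx0 : 0 < x := lt_of_lt_of_le (by norm_num) hx
  have hlog0 : 0 ≤ Real.log x := Real.log_nonneg (le_trans (by norm_num) hx)
  have hlog : Real.log x ≤ x ^ ((1 : ℝ) / 2) / (1 / 2) := Real.log_le_rpow_div hx0.le (by norm_num)
  have hsq : (x ^ ((1 : ℝ) / 2)) ^ 2 = x := by
    rw [← Real.rpow_natCast, ← Real.rpow_mul hx0.le]; norm_num
  have hr0 : 0 ≤ x ^ ((1 : ℝ) / 2) := Real.rpow_nonneg hx0.le _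
  have hr100 : 100 ≤ x ^ ((1 : ℝ) / 2) := by nlinarith [hsq, hr0]
  refine ⟨div_pos (by linarith) hx0, ?_⟩
  rw [div_le_one hx0]
  have : 5 * Real.log x + 20 ≤ 10 * x ^ ((1 : ℝ) / 2) + 20 := by
    have h := hlog; rw [div_div_eq_mul_div] at h; linarith
  nlinarith [hsq, hr100]

/-- The ignition budget is at most `log(1/ε̄)`: `max 0 (log(0.6√(B+4)/(ε̄B))) ≤ −log ε̄` for `B ≥ 2`,
`0 < ε̄ ≤ 1` (`0.36(B+4) ≤ B²`). [folklore] -/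
theorem oneStepCore_max_log_le {εb B : ℝ} (hεb : 0 < εb) (hεb1 : εb ≤ 1) (hB : 2 ≤ B) :
    max 0 (Real.log (6 / 10 * Real.sqrt (B + 4) / (εb * B))) ≤ -Real.log εb := by
  have hB0 : 0 < B := by linarith
  have hlogε : Real.log εb ≤ 0 := Real.log_nonpos hεb.le hεb1
  refine max_le (by linarith) ?_
  have hsq : Real.sqrt (B + 4) ≤ 5 / 3 * B := by
    rw [Real.sqrt_le_left (by positivity)]; nlinarith
  have hpos : 0 < 6 / 10 * Real.sqrt (B + 4) / (εb * B) := by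
    have : 0 < Real.sqrt (B + 4) := Real.sqrt_pos.2 (by linarith)
    positivity
  have hle : 6 / 10 * Real.sqrt (B + 4) / (εb * B) ≤ εb⁻¹ := by
    rw [div_le_iff₀ (by positivity)]
    have : εb⁻¹ * (εb * B) = B := by field_simp
    rw [this]; nlinarith [Real.sqrt_nonneg (B + 4)]
  calc Real.log (6 / 10 * Real.sqrt (B + 4) / (εb * B)) ≤ Real.log εb⁻¹ :=
        Real.log_le_log hpos hle
    _ = -Real.log εb := Real.log_inv εb

/-- `e^{-3} ≤ 1/20`. [folklore] -/
theorem oneStepCore_exp_neg_three_le : Real.exp (-3) ≤ 1 / 20 := by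
  have h1 : (2.7182818283 : ℝ) < Real.exp 1 := Real.exp_one_gt_d9
  have h3 : Real.exp 3 = Real.exp 1 ^ 3 := by rw [← Real.exp_nat_mul]; norm_num
  have h20 : (20 : ℝ) ≤ Real.exp 3 := by
    rw [h3]; nlinarith [Real.exp_pos 1, sq_nonneg (Real.exp 1)]
  rw [Real.exp_neg, inv_le_comm₀ (Real.exp_pos 3) (by norm_num)]
  simpa using h20

/-- NO IGNITION WITHIN THREE SLOW UNITS IS IMPOSSIBLE in the regime `b_lo ≥ 10⁴ + 40 + 5 log(1/ε̄)`:
the not-yet-ignited budget inequality NEW-1 of `stub_incubation` at `T = 3` fails. [folklore] -/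
theorem oneStepCore_no_ignition_contra {εb blo B : ℝ} (hεb : 0 < εb) (hεb1 : εb ≤ 1)
    (hblo : 10 ^ 4 + 40 - 5 * Real.log εb ≤ blo) (hB : blo ≤ B)
    (h : B * (1 - Real.exp (-3)) ≤
      max 0 (Real.log (6 / 10 * Real.sqrt (B + 4) / (εb * B))) + 6 * (3 + 1) + 2) : False := by
  have hlogε : Real.log εb ≤ 0 := Real.log_nonpos hεb.le hεb1
  have hB2 : 2 ≤ B := by linarith
  have hmax := oneStepCore_max_log_le hεb hεb1 hB2
  have he := oneStepCore_exp_neg_three_le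
  nlinarith

/-- THE FRONT CARRIER AT IGNITION IS `≥ 10⁴`: from NEW-1 on the pre-ignition horizon `τ ≤ 3` and the
incubation envelope `b ≥ Be^{-τ} − 3/2`. [folklore] -/
theorem oneStepCore_Bp_ge {εb blo B b τ : ℝ} (hεb : 0 < εb) (hεb1 : εb ≤ 1)
    (hblo : 10 ^ 4 + 40 - 5 * Real.log εb ≤ blo) (hB : blo ≤ B) (hτ3 : τ ≤ 3)
    (hnew1 : B * (1 - Real.exp (-τ)) ≤
      max 0 (Real.log (6 / 10 * Real.sqrt (B + 4) / (εb * B))) + 6 * (τ + 1) + 2)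
    (henv : B * Real.exp (-τ) - 3 / 2 ≤ b) : 10 ^ 4 ≤ b := by
  have hlogε : Real.log εb ≤ 0 := Real.log_nonpos hεb.le hεb1
  have hB2 : 2 ≤ B := by linarith
  have hmax := oneStepCore_max_log_le hεb hεb1 hB2
  nlinarith

/-- IGNITION HAPPENS AFTER `σ_I = 2Λ₀/B`, `Λ₀ = 100 + 4 log(b_hi + 5)`: from NEW-2 (upper bound on the
carrier at ignition), the envelope `b ≥ Be^{-τ} − 3/2 ≥ B(1−τ) − 3/2` and the seed budget
`log(1/ε̄) ≥ 10³ + 20 log(b_hi+5) + log(F+2)`. [folklore] -/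
theorem oneStepCore_sigmaI_le {εb F bhi B b τ : ℝ} (hεb : 0 < εb) (hF : 0 ≤ F) (hB1 : 1 ≤ B)
    (hBhi : B ≤ bhi) (hτ3 : τ ≤ 3)
    (hreg : 10 ^ 3 + 20 * Real.log (bhi + 5) + Real.log (F + 2) ≤ -Real.log εb)
    (hnew2 : b ≤ B + Real.log (10 * (F + 2) * εb * B) + 6 * (τ + 1))
    (henv : B * Real.exp (-τ) - 3 / 2 ≤ b) :
    2 * (100 + 4 * Real.log (bhi + 5)) / B ≤ τ := by
  have hB0 : 0 < B := by linarith
  have hexp : 1 - τ ≤ Real.exp (-τ) := Real.one_sub_le_exp_neg τ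
  have hlog10 : Real.log 10 ≤ 9 := by
    have := Real.log_le_sub_one_of_pos (show (0:ℝ) < 10 by norm_num); linarith
  have hlogB : Real.log B ≤ Real.log (bhi + 5) := Real.log_le_log hB0 (by linarith)
  have hlogbhi : 0 ≤ Real.log (bhi + 5) := Real.log_nonneg (by linarith)
  have hsplit : Real.log (10 * (F + 2) * εb * B) =
      Real.log 10 + Real.log (F + 2) + Real.log εb + Real.log B := by
    have h1 : (10 : ℝ) ≠ 0 := by norm_num
    have h2 : F + 2 ≠ 0 := by linarith
    rw [Real.log_mul (by positivity) hB0.ne', Real.log_mul (by positivity) hεb.ne',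
      Real.log_mul h1 h2]
  have hBτ : 2 * (100 + 4 * Real.log (bhi + 5)) ≤ B * τ := by
    have hb1 : B * (1 - τ) - 3 / 2 ≤ b := le_trans (by nlinarith) henv
    rw [hsplit] at hnew2
    nlinarith
  rw [div_le_iff₀ hB0]; linarith

/-- The front bond at hand-off is far below the ignition level: `(Fε̄B)² < B/100` in the regime
`ε̄·10⁹(F+1)²(b_hi+4)³ ≤ 1`. [folklore] -/
theorem oneStepCore_w0_sq_lt {εb F bhi B W : ℝ} (hεb : 0 < εb) (hF : 0 ≤ F) (hB1 : 1 ≤ B) (hBhi : B ≤ bhi)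
    (hreg : εb * (10 ^ 9 * (F + 1) ^ 2 * (bhi + 4) ^ 3) ≤ 1) (hW0 : 0 ≤ W) (hW : W ≤ F * εb * B) :
    W ^ 2 < B / 100 := by
  have hbhi1 : 1 ≤ bhi + 4 := by linarith
  have h1 : W ^ 2 ≤ (F * εb * B) ^ 2 := pow_le_pow_left₀ hW0 hW 2
  have h2 : (F * εb * B) ^ 2 ≤ ((F + 1) * εb * (bhi + 4)) ^ 2 := by
    apply pow_le_pow_left₀ (by positivity)
    have : F * εb * B ≤ (F + 1) * εb * B := by nlinarith
    nlinarith [mul_nonneg (by positivity : (0:ℝ) ≤ (F + 1) * εb) (by linarith : (0:ℝ) ≤ bhi + 4 - B)]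
  -- ((F+1) εb (bhi+4))² = εb · [εb (F+1)² (bhi+4)³] / (bhi+4) ≤ εb · 10⁻⁹ / (bhi+4) < B/100
  have h3 : ((F + 1) * εb * (bhi + 4)) ^ 2 * (10 ^ 9 * (bhi + 4)) =
      εb * (εb * (10 ^ 9 * (F + 1) ^ 2 * (bhi + 4) ^ 3)) := by ring
  have h4 : ((F + 1) * εb * (bhi + 4)) ^ 2 * (10 ^ 9 * (bhi + 4)) ≤ εb := by
    rw [h3]; nlinarith
  have hεb1 : εb ≤ 1 := by
    have : (1:ℝ) ≤ 10 ^ 9 * (F + 1) ^ 2 * (bhi + 4) ^ 3 := by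
      have : (1:ℝ) ≤ (F + 1) ^ 2 := by nlinarith
      nlinarith [pow_le_pow_left₀ (by norm_num : (0:ℝ) ≤ 1) hbhi1 3]
    nlinarith
  have h5 : ((F + 1) * εb * (bhi + 4)) ^ 2 < B / 100 := by
    have hpos : (0:ℝ) < 10 ^ 9 * (bhi + 4) := by positivity
    have : ((F + 1) * εb * (bhi + 4)) ^ 2 ≤ εb / (10 ^ 9 * (bhi + 4)) := by
      rw [le_div_iff₀ hpos]; exact h4
    refine lt_of_le_of_lt this ?_
    rw [div_lt_div_iff₀ hpos (by norm_num)]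
    nlinarith
  linarith

/-- THE FIRST IGNITION TIME: a continuous `g` on `[a,c]` with `g(a) < 0` either stays negative on `[a,c]`
or has a first zero `tι ∈ (a,c]` before which it is negative (apply with `g = w_n² − b_n/100`). [folklore] -/
theorem oneStepCore_first_zero {g : ℝ → ℝ} {a c : ℝ} (hg : ContinuousOn g (Icc a c))
    (ha : g a < 0) :
    (∀ s ∈ Icc a c, g s < 0) ∨ ∃ tι ∈ Ioc a c, g tι = 0 ∧ ∀ s ∈ Ico a tι, g s < 0 := by
  by_cases h : ∀ s ∈ Icc a c, g s < 0
  · exact Or.inl h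
  · right
    push Not at h
    obtain ⟨s, hs, hgs⟩ := h
    obtain ⟨tι, htι, h0, hneg⟩ :=
      ivtNesting_exists_first_eq hs.1 (hg.mono (Icc_subset_Icc_right hs.2)) ha.le hgs
    have hta : a < tι := by
      rcases eq_or_lt_of_le htι.1 with h' | h'
      · rw [← h'] at h0; linarith
      · exact h'
    exact ⟨tι, ⟨hta, htι.2.trans hs.2⟩, h0, hneg⟩

/-- **Registered tools stub `stub_oneStepCoreTools`** (line `Sketch`, crux stmt-NavierStokesRegularity-1835): the pulse
horizon `σ_P = (5 log x + 20)/x` is positive and at most one slow unit for `x ≥ 10⁴`. [folklore] -/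
theorem stub_oneStepCoreTools :
    ∀ x : ℝ, 10 ^ 4 ≤ x → 0 < (5 * Real.log x + 20) / x ∧ (5 * Real.log x + 20) / x ≤ 1 :=
  fun _ hx => oneStepCore_sigmaP_bounds hx

/-- **Elementary consequences of the one-step regime** used by `stub_oneStepCore`: `ε̄ ≤ 1`, `B ≥ 10⁴`,
`F ≥ 0`, `Fε̄B ≤ 1`, `ε̄(b_hi+4)² ≤ 1`, `1 ≤ q ≤ 21/20`. [folklore] -/
theorem oneStepCore_regime {ε₀ εb F blo bhi B q : ℝ} (hε₀ : 0 < ε₀) (hε₀' : ε₀ ≤ 1 / 20) (hεb : 0 < εb)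
    (hεb6 : εb ≤ 1 / 10 ^ 6) (hblo : 10 ^ 4 + 40 - 5 * Real.log εb ≤ blo) (hF : 10 ^ 9 * (bhi + 4) ^ 4 ≤ F)
    (hεbreg : εb * (10 ^ 9 * (F + 1) ^ 2 * (bhi + 4) ^ 3) ≤ 1) (hBlo : blo ≤ B) (hBhi : B ≤ bhi)
    (hq : q = Real.sqrt (1 + ε₀)) :
    εb ≤ 1 ∧ 10 ^ 4 ≤ B ∧ 1 ≤ B ∧ 0 ≤ F ∧ F * εb * B ≤ 1 ∧ εb * (bhi + 4) ^ 2 ≤ 1 ∧ 1 ≤ q ∧ q ≤ 21 / 20 := by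
  have hεb1 : εb ≤ 1 := hεb6.trans (by norm_num)
  have hlogε : Real.log εb ≤ 0 := Real.log_nonpos hεb.le hεb1
  have hB4 : 10 ^ 4 ≤ B := by linarith
  have hB1 : (1:ℝ) ≤ B := le_trans (by norm_num) hB4
  have hbhi4 : (1:ℝ) ≤ bhi + 4 := by linarith
  have hF0 : (0:ℝ) ≤ F := le_trans (by positivity) hF
  have hbig : (1:ℝ) ≤ 10 ^ 9 * (F + 1) * (bhi + 4) := by nlinarith
  have hFεB : F * εb * B ≤ 1 := by
    have h1 : F * εb * B ≤ (F + 1) * εb * (bhi + 4) := by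
      have := mul_le_mul (show F ≤ F + 1 by linarith) (show B ≤ bhi + 4 by linarith) (by linarith) (by linarith)
      nlinarith [mul_le_mul_of_nonneg_left this hεb.le]
    have h2 : (F + 1) * εb * (bhi + 4) ≤ (F + 1) * εb * (bhi + 4) * (10 ^ 9 * (F + 1) * (bhi + 4)) :=
      le_mul_of_one_le_right (by positivity) hbig
    have h3 : (F + 1) * εb * (bhi + 4) * (10 ^ 9 * (F + 1) * (bhi + 4)) =
        εb * (10 ^ 9 * (F + 1) ^ 2 * (bhi + 4) ^ 3) / (bhi + 4) := by
      field_simp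
    have h4 : εb * (10 ^ 9 * (F + 1) ^ 2 * (bhi + 4) ^ 3) / (bhi + 4) ≤ 1 / 1 :=
      div_le_div₀ (by norm_num) hεbreg (by norm_num) hbhi4
    linarith
  have hεbhi2 : εb * (bhi + 4) ^ 2 ≤ 1 := by
    have h2 : εb * (bhi + 4) ^ 2 ≤ εb * (bhi + 4) ^ 2 * (10 ^ 9 * (F + 1) * (bhi + 4)) :=
      le_mul_of_one_le_right (by positivity) hbig
    have h3 : εb * (bhi + 4) ^ 2 * (10 ^ 9 * (F + 1) * (bhi + 4)) ≤
        εb * (10 ^ 9 * (F + 1) ^ 2 * (bhi + 4) ^ 3) := by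
      have : (10:ℝ) ^ 9 * (F + 1) * (bhi + 4) ≤ 10 ^ 9 * (F + 1) ^ 2 * (bhi + 4) := by nlinarith
      nlinarith [mul_le_mul_of_nonneg_left this (by positivity : (0:ℝ) ≤ εb * (bhi + 4) ^ 2)]
    linarith
  have hq1 : 1 ≤ q := by rw [hq]; exact Real.one_le_sqrt.2 (by linarith)
  have hq2 : q ≤ 21 / 20 := by rw [hq, Real.sqrt_le_left (by norm_num)]; nlinarith
  exact ⟨hεb1, hB4, hB1, hF0, hFεB, hεbhi2, hq1, hq2⟩

/-- **The front clock**: for `c = R n > 0`, `t ≤ t₀ + 3/c ⇒ c(t − t₀) ≤ 3`, `t₀ ≤ t ⇒ 0 ≤ c(t−t₀)`,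
`3/c + 1/c = 4/c`, and the conversion `a/B ≤ c(tι − t₀) ⇒ t₀ + a/(Bc) ≤ tι`. [folklore] -/
theorem oneStepCore_clock {c t₀ : ℝ} (hc : 0 < c) :
    (∀ t : ℝ, t ≤ t₀ + 3 / c → c * (t - t₀) ≤ 3) ∧ (∀ t : ℝ, t₀ ≤ t → 0 ≤ c * (t - t₀)) ∧
    3 / c + 1 / c = 4 / c ∧ 0 < 3 / c ∧
    (∀ a B tι : ℝ, a / B ≤ c * (tι - t₀) → t₀ + a / (B * c) ≤ tι) := by
  refine ⟨fun t ht => ?_, fun t ht => mul_nonneg hc.le (by linarith), by ring, div_pos (by norm_num) hc,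
    fun a B tι h => ?_⟩
  · have h1 : t - t₀ ≤ 3 / c := by linarith
    calc c * (t - t₀) ≤ c * (3 / c) := mul_le_mul_of_nonneg_left h1 hc.le
      _ = 3 := mul_div_cancel₀ _ hc.ne'
  · have h2 : a / (B * c) = a / B / c := by rw [div_div]
    have h3 : a / B / c ≤ tι - t₀ := by rw [div_le_iff₀ hc]; linarith
    linarith

/-- `B e^{-x} ≤ B` for `x, B ≥ 0`. [folklore] -/
theorem oneStepCore_mul_exp_neg_le {B x : ℝ} (hB : 0 ≤ B) (hx : 0 ≤ x) : B * Real.exp (-x) ≤ B :=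
  mul_le_of_le_one_right hB (Real.exp_le_one_iff.2 (by linarith))

end Summit.NavierStokesRegularity.NavierStokesRegularity.Theorems.PerpetualPumpAveragedTypeIBlowup

end
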